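import Summits.AnomalousDissipation.AnomalousDissipation.Theorems.SolenoidalFractalHomogenisationLagrangianStepD1TailCert
import HarnessLib

/-!
# K1L_D `stub_D1_V0thg` (stmt-AnomalousDissipation-27980), R3′ lane — R3′-2 CERT SOCKET `D1TailCrushCert`: the tail certificate with a SCALED table
# (`λ·gTab`, per-pair bounds crushed by a ν-dependent factor `E(ν)` ⇒ `RelSmall (psiStar − excQS − pairQS) excQS (E(ν)/200000)`)

Helper file of route `SolenoidalFractalHomogenisation` (`--supports stmt-AnomalousDissipation-27980 --as helper`; one-generation hand
`leafhand-ad-solenoidalfractalh-1` g0, road E-c).  The R3′ plan memo (`Cruxes/LagrangianRenormalisationStepDesign/Lines/onelevel-vtheta-R3-plan.md` §5,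
R3′-2) replaces the in-slot ν-free decay `exp(−θmin)` of the table of record `gTab` (TAIL-CERT, `…D1TailCert`) by the crushing factor of the first
hopping intermediate slot (now in the tree: `Sideband.ladder_crush_slot_nu_exists`, `…SidebandLadderCrushSlotNuExists`), i.e. it proves the per-pair
bounds of lane A4 with `E(ν)·gTab j j'` in place of `gTab j j'`, `E(ν) = C·exp(−c·ν^{−1/3})`.  This file is the ν-SCALED COMPOSITION SOCKET that turns
such bounds into the relative smallness the (V_θg) assembly consumes:
* `frob_smul_table` — the Frobenius weight of `λ·g` is `λ²` times that of `g`;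
* `relSmall_tail_of_scaledTable` — `relSmall_tail_of_table` with the table `λ·g` (`λ ≥ 0`, `Σ g²/(w w') ≤ (1/23)²`): size `λ/200000`;
* `residueTail_of_crushedSlotPairBounds` — the R3′-2 output shape: slot-pair presentation (lane A1, ν-uniform) + per-pair bounds with `E ν·gTab` ⇒
  `∀ ν ∈ (0, νB₁], … RelSmall (psiStar − excQS − pairQS) (excQS) (E ν/200000)`.
What is NOT here: the crushed per-pair bounds themselves (`D1TailCrushBound`, the ν-dependent twin of lane A4 over the path classes of
`SidebandPathCensus`) and the crush table bookkeeping (`D1TailCrushTable`).  No definitions, no sorry.  NOT a proof of `stub_D1_V0thg`, of K1L_D or of AD;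
rung F-D1.A0 infrastructure.
-/

set_option linter.dupNamespace false

namespace Summit.AnomalousDissipation.AnomalousDissipation.Theorems.SolenoidalFractalHomogenisation.LagrangianStep.D1TailCert

open Summit.AnomalousDissipation.AnomalousDissipation.Theorems
open Summit.AnomalousDissipation.AnomalousDissipation.Theorems.SolenoidalFractalHomogenisation.LagrangianStep
open Summit.AnomalousDissipation.AnomalousDissipation.Theorems.SolenoidalFractalHomogenisation.LagrangianStep.WCrossing
open Summit.AnomalousDissipation.AnomalousDissipation.Theorems.SolenoidalFractalHomogenisation.LagrangianStep.WEvenCert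
open Summit.AnomalousDissipation.AnomalousDissipation.Theorems.SolenoidalFractalHomogenisation.LagrangianStep.D1ResidueCert
open Literature.Analysis Literature.Analysis.FluidPDE Literature.Analysis.FunctionSpaces
open Set Real

noncomputable section

/-- The Frobenius weight of the scaled table `λ·g` is `λ²` times that of `g` (any real `λ`). [folklore] -/
theorem frob_smul_table {g : Fin 26 → Fin 26 → ℝ} {ε : ℝ} (lam : ℝ) (hg : ∑ j, ∑ j', g j j' ^ 2 / (wN j * wN j') ≤ ε ^ 2) :
    ∑ j, ∑ j', (lam * g j j') ^ 2 / (wN j * wN j') ≤ (lam * ε) ^ 2 := by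
  have e : ∑ j, ∑ j', (lam * g j j') ^ 2 / (wN j * wN j') = lam ^ 2 * ∑ j, ∑ j', g j j' ^ 2 / (wN j * wN j') := by
    rw [Finset.mul_sum]
    refine Finset.sum_congr rfl fun j _ => ?_
    rw [Finset.mul_sum]
    refine Finset.sum_congr rfl fun j' _ => ?_
    ring
  rw [e, mul_pow]
  exact mul_le_mul_of_nonneg_left hg (sq_nonneg lam)

/-- **Generic composition with a SCALED table.**  ANY table `g` with Frobenius weight `≤ (1/23)²` and any real `λ` (in use `λ ≥ 0`): a slot-pair presentation of
`bsymb R` with per-pair bounds `|F_{jj'}(p,q)| ≤ λ·g j j'·|P_j p|·|P_{j'} q|` makes `R` `RelSmall` of size `λ/200000` relative to `excQS` on the sectorial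
block window (the `λ = 1` case is `relSmall_tail_of_table`). [folklore] -/
theorem relSmall_tail_of_scaledTable {R S : T4} {g : Fin 26 → Fin 26 → ℝ} (hg : ∑ j, ∑ j', g j j' ^ 2 / (wN j * wN j') ≤ (1 / 23) ^ 2)
    (lam : ℝ)
    (hS : Torus.NearIso S (10 / 11) (11 / 10)) {τ : ℝ} (hτ : τ ∈ Set.Icc (0:ℝ) (1 / 20)) (hodd : OddSectorial S τ)
    (F : (Fin 3 → ℝ) → (Fin 3 → ℝ) → Fin 26 → Fin 26 → ℝ)
    (hstruct : ∀ k p q : Fin 3 → ℝ, ∑ i, p i * k i = 0 → ∑ i, q i * k i = 0 →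
      Torus.bsymb R k p q = ∑ j, ∑ j', ek j k * ek j' k * F p q j j')
    (hbound : ∀ p q : Fin 3 → ℝ, ∀ j j', |F p q j j'| ≤ lam * g j j' * (Real.sqrt (PpSq j p) * Real.sqrt (PpSq j' q))) :
    RelSmall R (excQS cubatureWord MB S) (lam / 200000) := by
  have e : lam / 200000 = (lam * (1 / 23)) * ρP := by
    rw [mul_assoc, one_div_23_mul_ρP]; ring
  rw [e]
  exact relSmall_of_Nbar hS hτ hodd fun k p q hp hq =>
    sq_le_of_slotPair (g := fun j j' => lam * g j j') (hstruct k p q hp hq) (hbound p q) (frob_smul_table lam hg)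

/-- **R3′-2 OUTPUT SHAPE: the tail from CRUSHED slot-pair bounds.**  If the tail's bilinear symbol has the slot-pair presentation of lane A1 and the
676 per-pair bounds hold with the table of record `gTab` scaled by a ν-dependent factor `E ν` (in use `≥ 0`: the crushing factor of the first hopping intermediate
slot in place of the ν-free in-slot decay), then for every `ν ∈ (0, νB₁]` the tail is `RelSmall` of size `E ν/200000` relative to `excQS` on the sectorial
block window. [folklore] -/
theorem residueTail_of_crushedSlotPairBounds (E : ℝ → ℝ)
    (F : ℝ → T4 → (Fin 3 → ℝ) → (Fin 3 → ℝ) → Fin 26 → Fin 26 → ℝ)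
    (hstruct : ∀ ν ∈ Set.Ioc 0 νB₁, ∀ S : Torus.Visc4 (Fin 3), Torus.NearIso S (10 / 11) (11 / 10) →
      ∀ τ ∈ Set.Icc (0:ℝ) (1 / 20), OddSectorial S τ → ∀ k p q : Fin 3 → ℝ, ∑ i, p i * k i = 0 → ∑ i, q i * k i = 0 →
        Torus.bsymb (Sideband.psiStar cubatureWord MB MB_pos ν S - excQS cubatureWord MB S - pairQS S) k p q
          = ∑ j, ∑ j', ek j k * ek j' k * F ν S p q j j')
    (hbound : ∀ ν ∈ Set.Ioc 0 νB₁, ∀ S : Torus.Visc4 (Fin 3), Torus.NearIso S (10 / 11) (11 / 10) →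
      ∀ τ ∈ Set.Icc (0:ℝ) (1 / 20), OddSectorial S τ →
        ∀ p q : Fin 3 → ℝ, ∀ j j', |F ν S p q j j'| ≤ E ν * gTab j j' * (Real.sqrt (PpSq j p) * Real.sqrt (PpSq j' q))) :
    ∀ ν ∈ Set.Ioc 0 νB₁, ∀ S : Torus.Visc4 (Fin 3), Torus.NearIso S (10 / 11) (11 / 10) →
      ∀ τ ∈ Set.Icc (0:ℝ) (1 / 20), OddSectorial S τ →
        RelSmall (Sideband.psiStar cubatureWord MB MB_pos ν S - excQS cubatureWord MB S - pairQS S)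
          (excQS cubatureWord MB S) (E ν / 200000) :=
  fun ν hν S hS τ hτ hodd =>
    relSmall_tail_of_scaledTable frob_gTab_le (E ν) hS hτ hodd (F ν S) (hstruct ν hν S hS τ hτ hodd) (hbound ν hν S hS τ hτ hodd)

end

end Summit.AnomalousDissipation.AnomalousDissipation.Theorems.SolenoidalFractalHomogenisation.LagrangianStep.D1TailCert
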